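import Summits.QuantumFields.BalabanUV.T4Continuum.Support.NE7FluxGradientFromTension
import Summits.QuantumFields.BalabanUV.T4Continuum.Support.AveragingDeficitCovGrad
import Summits.QuantumFields.BalabanUV.T4Continuum.Support.NE3CoercivityScaling
import HarnessLib

/-!
# NE7FluxHodgeDivForm — supplier stub (S-h) of the NE7 crux, parts (c1)–(c2) (ROAD-G108 §4): THE FLAT POINTWISE HODGE IDENTITY FOR A 2-COCHAIN IN DIVERGENCE FORM,
# `Δb_{μν} = flatDiv q_{μν}` with `q` built from the flat exterior derivative and codifferential of `b` ONLY, and the ZEROTH-ORDER near-flat comparison of the flat `d, δ, ∇⁺`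
# with the covariant `cyc, T, cD` at a unitary background — the kinematic half of «(10) TYPE up to a logarithm» (no derivative of `b` on the right: `r = 0`, no bootstrap)

Cell `pub-balaban`, rung (B)+1 sub-cell t4, lineage `b2b-balaban-t4-ne7-p1`, generation 108 (CRUX PROVER NE7 #1 = OWNER of BINDER row NE7).  Memo `t4/b2b-balaban-t4-ne7-p1-g108/ROAD-G108.md` §4 (c).
WHY.  The next supplier (S-h) proves the pointwise flux-gradient regularity of minimisers, `‖∇_U F‖ ≤ c(1+k)η³`, from row NE7b's flat interior letter with a divergence-form source
(`NE7FlatInteriorGradientDivForm.interior_gradient_divForm`, gen 155: `Δu = flatDiv q + r`, `|u| ≤ A` on `cube x (3m)` ⟹ `|∇u(x)| ≤ C[(1 + log⁺3m)sup|q| + m·sup|r| + A∕m]`).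
The component equation comes from THIS file: (c1) for ANY `b : Site d → Fin d → Fin d → 𝕄` and all `x μ ν`, EXACTLY,
  `Σ_κ (∇⁺_κ∇⁻_κ b_{μν})(x) = flatDiv (q b μ ν) x`,  `q b μ ν (y, κ) = (db)_{κμν}(y) + [κ = μ]·(δb)_ν(y+e_μ) − [κ = ν]·(δb)_μ(y+e_ν)`,
with `(db)_{κμν} := ∇⁺_κ b_{μν} − ∇⁺_μ b_{κν} + ∇⁺_ν b_{κμ}` (the sign pattern of `NE7LatticeBianchi.covariant_bianchi_le`) and `(δb)_ν := Σ_κ ∇⁻_κ b_{κν}` (`= flatDiv (b · · ν)`) — pure shift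
algebra, no antisymmetry used; (c2) at a unitary `V` the flat objects differ from the covariant ones by ZEROTH-ORDER terms: `‖∇⁺_κ f(y) − cD V κ f y‖ ≤ 2‖V(y,κ) − 1‖·‖f(y+e_κ)‖`,
`‖(δb)_ν(y) + Σ_κ cDstar V κ (b · κ ν) y‖ ≤ 2Σ_κ‖V(y−e_κ,κ) − 1‖·‖b(y−e_κ) κ ν‖` (the tension is MINUS the covariant backward divergence), and, for antisymmetric `b`, `(db)_{κμν}` differs from the
cyclic covariant sum `cD_κ b_{μν} + cD_μ b_{νκ} + cD_ν b_{κμ}` of `NE7FluxGradientFromTension.norm_cyc_le` by `≤ 2(‖V(y,κ)−1‖‖b(y+e_κ)μν‖ + ‖V(y,μ)−1‖‖b(y+e_μ)νκ‖ + ‖V(y,ν)−1‖‖b(y+e_ν)κμ‖)`.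
So in a comb gauge (`‖V − 1‖ ≤ τ = O(Ma)` on a cube) the flux components solve `Δb = flatDiv q` with `sup‖q‖ ≤ sup‖cyc‖ + 2·sup‖T‖ + 14dτ·sup‖b‖` — `r = 0`, nothing to absorb.
WHAT ([folklore]; 0 def, 0 sorry; any `d`, any additive-commutative-group-valued `b` for (c1), `Matrix n n ℂ` for (c2)).  §1 `lap_twoForm_eq_flatDiv` (c1) and its letter `norm_hodgeQ_le`;
§2 `norm_fdiff_sub_cD_le`, `norm_flatCodiff_add_tension_le`, `norm_flatExt_sub_cyc_le`, `covGrad_flux_eq_cD` (c2).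
HONEST FRAMING (page 1): lattice calculus at ONE configuration; nothing about minimisers; NOT (10) TYPE (parts (c3)–(c5): comb gauge, assembly, docking remain), NOT NE3∕NE7; spine 0∕9;
finite T⁴ rung (B)+1 — NOT infinite volume, NOT mass gap, NOT BetaPertH, NOT Clay.
-/

set_option autoImplicit false

open scoped BigOperators Matrix Matrix.Norms.L2Operator
open NormedSpace Finset

namespace Summit.QuantumFields.BalabanUV.T4Continuum.NE7FluxHodgeDivForm

open Literature.MathematicalPhysics.QuantumFieldTheory.Balaban1983to89
open B7Prop1Explicit B7Prop2Explicit
open T4AveragingDeficitWall (IsUnitaryCfg Ad covGrad flux)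
open AveragingDeficitNearIdentity (norm_Ad_sub_le)
open AveragingDeficitCovGrad (norm_Ad_inv_sub_le)
open NE3CovariantCalculus (cD cDstar)
open NE3CoercivityScaling (flatDiv)

noncomputable section

variable {d : ℕ} {n : Type*} [Fintype n] [DecidableEq n]

/-! ## §1 (c1) The flat pointwise Hodge identity in divergence form -/

omit [Fintype n] [DecidableEq n] in
/-- **THE FLAT POINTWISE HODGE IDENTITY FOR A 2-COCHAIN, IN DIVERGENCE FORM** (any `b`, no antisymmetry needed): for all `x μ ν`,
`Σ_κ [(b(x+e_κ) − b x) − (b x − b(x−e_κ))]_{μν} = flatDiv q x` with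
`q y κ = (db)_{κμν}(y) + [κ=μ](δb)_ν(y+e_μ) − [κ=ν](δb)_μ(y+e_ν)`, `(db)_{κμν} = ∇⁺_κb_{μν} − ∇⁺_μb_{κν} + ∇⁺_νb_{κμ}`, `(δb)_ν(y) = Σ_λ (b y λ ν − b (y−e_λ) λ ν)`. [folklore] -/
theorem lap_twoForm_eq_flatDiv (b : Site d → Fin d → Fin d → Matrix n n ℂ) (x : Site d) (μ ν : Fin d) :
    ∑ κ : Fin d, ((b (x + e κ) μ ν - b x μ ν) - (b x μ ν - b (x - e κ) μ ν))
      = flatDiv (fun y κ =>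
          ((b (y + e κ) μ ν - b y μ ν) - (b (y + e μ) κ ν - b y κ ν) + (b (y + e ν) κ μ - b y κ μ))
          + (if κ = μ then ∑ lam : Fin d, (b (y + e μ) lam ν - b (y + e μ - e lam) lam ν) else 0)
          - (if κ = ν then ∑ lam : Fin d, (b (y + e ν) lam μ - b (y + e ν - e lam) lam μ) else 0)) x := by
  unfold flatDiv
  -- the shifts `x − e_κ + e_τ = x + e_τ − e_κ`, `x + e_κ − e_κ = x`; distribute the sums; the codifferential sums cancel (`abel` on sum atoms)
  have hs : ∀ κ τ : Fin d, x - e κ + e τ = x + e τ - e κ := fun κ τ => by abel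
  simp only [hs, add_sub_cancel_right, Finset.sum_sub_distrib, Finset.sum_add_distrib, Finset.sum_ite_eq', Finset.mem_univ, if_true]
  abel

/-- **THE LETTER OF THE HODGE SOURCE**: if `‖(db)_{κμν}(y)‖ ≤ Db` and `‖(δb)_λ(z)‖ ≤ Tb` at the sites read, then `‖q y κ‖ ≤ Db + 2Tb`. [folklore] -/
theorem norm_hodgeQ_le (b : Site d → Fin d → Fin d → Matrix n n ℂ) (y : Site d) (μ ν κ : Fin d) {Db Tb : ℝ}
    (hD : ‖(b (y + e κ) μ ν - b y μ ν) - (b (y + e μ) κ ν - b y κ ν) + (b (y + e ν) κ μ - b y κ μ)‖ ≤ Db)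
    (hT0 : 0 ≤ Tb)
    (hTμ : ‖∑ lam : Fin d, (b (y + e μ) lam ν - b (y + e μ - e lam) lam ν)‖ ≤ Tb)
    (hTν : ‖∑ lam : Fin d, (b (y + e ν) lam μ - b (y + e ν - e lam) lam μ)‖ ≤ Tb) :
    ‖((b (y + e κ) μ ν - b y μ ν) - (b (y + e μ) κ ν - b y κ ν) + (b (y + e ν) κ μ - b y κ μ))
        + (if κ = μ then ∑ lam : Fin d, (b (y + e μ) lam ν - b (y + e μ - e lam) lam ν) else 0)
        - (if κ = ν then ∑ lam : Fin d, (b (y + e ν) lam μ - b (y + e ν - e lam) lam μ) else 0)‖ ≤ Db + 2 * Tb := by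
  have h1 : ‖(if κ = μ then ∑ lam : Fin d, (b (y + e μ) lam ν - b (y + e μ - e lam) lam ν) else 0)‖ ≤ Tb := by
    split_ifs
    · exact hTμ
    · rw [norm_zero]; exact hT0
  have h2 : ‖(if κ = ν then ∑ lam : Fin d, (b (y + e ν) lam μ - b (y + e ν - e lam) lam μ) else 0)‖ ≤ Tb := by
    split_ifs
    · exact hTν
    · rw [norm_zero]; exact hT0
  calc _ ≤ ‖((b (y + e κ) μ ν - b y μ ν) - (b (y + e μ) κ ν - b y κ ν) + (b (y + e ν) κ μ - b y κ μ))
          + (if κ = μ then ∑ lam : Fin d, (b (y + e μ) lam ν - b (y + e μ - e lam) lam ν) else 0)‖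
        + ‖(if κ = ν then ∑ lam : Fin d, (b (y + e ν) lam μ - b (y + e ν - e lam) lam μ) else 0)‖ := norm_sub_le _ _
    _ ≤ (Db + Tb) + Tb := add_le_add ((norm_add_le _ _).trans (add_le_add hD h1)) h2
    _ = Db + 2 * Tb := by ring

/-! ## §2 (c2) The zeroth-order near-flat comparison with the covariant objects -/

/-- **FLAT FORWARD DIFFERENCE vs COVARIANT DERIVATIVE**: `‖(f(y+e_κ) − f y) − cD V κ f y‖ ≤ 2‖V(y,κ) − 1‖·‖f(y+e_κ)‖` for unitary `V`. [folklore] -/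
theorem norm_fdiff_sub_cD_le [Nonempty n] {V : Site d → Fin d → (Matrix n n ℂ)ˣ} (hV : IsUnitaryCfg V) (f : Site d → Matrix n n ℂ)
    (y : Site d) (κ : Fin d) :
    ‖(f (y + e κ) - f y) - cD V κ f y‖ ≤ 2 * ‖((V y κ : (Matrix n n ℂ)ˣ) : Matrix n n ℂ) - 1‖ * ‖f (y + e κ)‖ := by
  unfold cD
  have e1 : f (y + e κ) - f y - (Ad (V y κ) (f (y + e κ)) - f y) = -(Ad (V y κ) (f (y + e κ)) - f (y + e κ)) := by abel
  rw [e1, norm_neg]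
  exact norm_Ad_sub_le (hV y κ) _

/-- **THE COVARIANT FLUX GRADIENT IS `cD` OF THE FLUX FORM**: `covGrad V (flux V) y κ ⟨(μ,ν),h⟩ = cD V κ (b · μ ν) y` when `b_{μν} = flux(μ<ν)`. [folklore] -/
theorem covGrad_flux_eq_cD (V : Site d → Fin d → (Matrix n n ℂ)ˣ) {b : Site d → Fin d → Fin d → Matrix n n ℂ}
    (hBF : ∀ (x : Site d) (μ ν : Fin d) (h : μ < ν), b x μ ν = flux V (x, ⟨(μ, ν), h⟩))
    (y : Site d) (κ : Fin d) {μ ν : Fin d} (h : μ < ν) :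
    covGrad V (flux V) y κ ⟨(μ, ν), h⟩ = cD V κ (fun w => b w μ ν) y := by
  show Ad (V y κ) (flux V (y + e κ, ⟨(μ, ν), h⟩)) - flux V (y, ⟨(μ, ν), h⟩) = Ad (V y κ) (b (y + e κ) μ ν) - b y μ ν
  rw [hBF (y + e κ) μ ν h, hBF y μ ν h]

/-- **FLAT CODIFFERENTIAL vs TENSION** (the tension `Σ_κ cDstar V κ (b · κ ν)` is MINUS the covariant backward divergence):
`‖Σ_κ (b y κ ν − b (y−e_κ) κ ν) + Σ_κ cDstar V κ (b · κ ν) y‖ ≤ Σ_κ 2‖V(y−e_κ,κ) − 1‖·‖b (y−e_κ) κ ν‖`. [folklore] -/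
theorem norm_flatCodiff_add_tension_le [Nonempty n] {V : Site d → Fin d → (Matrix n n ℂ)ˣ} (hV : IsUnitaryCfg V)
    (b : Site d → Fin d → Fin d → Matrix n n ℂ) (y : Site d) (ν : Fin d) :
    ‖∑ κ : Fin d, (b y κ ν - b (y - e κ) κ ν) + ∑ κ : Fin d, cDstar V κ (fun w => b w κ ν) y‖
      ≤ ∑ κ : Fin d, 2 * ‖((V (y - e κ) κ : (Matrix n n ℂ)ˣ) : Matrix n n ℂ) - 1‖ * ‖b (y - e κ) κ ν‖ := by
  rw [← Finset.sum_add_distrib]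
  refine (norm_sum_le _ _).trans (Finset.sum_le_sum fun κ _ => ?_)
  unfold cDstar
  have e1 : b y κ ν - b (y - e κ) κ ν + (Ad (V (y - e κ) κ)⁻¹ (b (y - e κ) κ ν) - b y κ ν)
      = Ad (V (y - e κ) κ)⁻¹ (b (y - e κ) κ ν) - b (y - e κ) κ ν := by abel
  rw [e1]
  exact norm_Ad_inv_sub_le (hV (y - e κ) κ) _

/-- **FLAT EXTERIOR DERIVATIVE vs THE COVARIANT CYCLIC SUM** (antisymmetric `b`): the flat `(db)_{κμν} = ∇⁺_κb_{μν} − ∇⁺_μb_{κν} + ∇⁺_νb_{κμ}` differs from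
`cD_κ b_{μν} + cD_μ b_{νκ} + cD_ν b_{κμ}` by `≤ 2(‖V(y,κ)−1‖‖b(y+e_κ)μν‖ + ‖V(y,μ)−1‖‖b(y+e_μ)νκ‖ + ‖V(y,ν)−1‖‖b(y+e_ν)κμ‖)`. [folklore] -/
theorem norm_flatExt_sub_cyc_le [Nonempty n] {V : Site d → Fin d → (Matrix n n ℂ)ˣ} (hV : IsUnitaryCfg V)
    {b : Site d → Fin d → Fin d → Matrix n n ℂ} (hanti : ∀ (x : Site d) (μ ν : Fin d), b x ν μ = -b x μ ν) (y : Site d) (κ μ ν : Fin d) :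
    ‖((b (y + e κ) μ ν - b y μ ν) - (b (y + e μ) κ ν - b y κ ν) + (b (y + e ν) κ μ - b y κ μ))
        - (cD V κ (fun w => b w μ ν) y + cD V μ (fun w => b w ν κ) y + cD V ν (fun w => b w κ μ) y)‖
      ≤ 2 * ‖((V y κ : (Matrix n n ℂ)ˣ) : Matrix n n ℂ) - 1‖ * ‖b (y + e κ) μ ν‖
        + 2 * ‖((V y μ : (Matrix n n ℂ)ˣ) : Matrix n n ℂ) - 1‖ * ‖b (y + e μ) ν κ‖
        + 2 * ‖((V y ν : (Matrix n n ℂ)ˣ) : Matrix n n ℂ) - 1‖ * ‖b (y + e ν) κ μ‖ := by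
  -- the middle flat term in the `νκ` order by antisymmetry
  have hmid : -(b (y + e μ) κ ν - b y κ ν) = b (y + e μ) ν κ - b y ν κ := by
    rw [hanti (y + e μ) ν κ, hanti y ν κ]; abel
  have e1 : ((b (y + e κ) μ ν - b y μ ν) - (b (y + e μ) κ ν - b y κ ν) + (b (y + e ν) κ μ - b y κ μ))
        - (cD V κ (fun w => b w μ ν) y + cD V μ (fun w => b w ν κ) y + cD V ν (fun w => b w κ μ) y)
      = ((b (y + e κ) μ ν - b y μ ν) - cD V κ (fun w => b w μ ν) y)
        + (-(b (y + e μ) κ ν - b y κ ν) - cD V μ (fun w => b w ν κ) y)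
        + ((b (y + e ν) κ μ - b y κ μ) - cD V ν (fun w => b w κ μ) y) := by abel
  rw [e1, hmid]
  have t1 := norm_fdiff_sub_cD_le hV (fun w => b w μ ν) y κ
  have t2 := norm_fdiff_sub_cD_le hV (fun w => b w ν κ) y μ
  have t3 := norm_fdiff_sub_cD_le hV (fun w => b w κ μ) y ν
  calc _ ≤ ‖((b (y + e κ) μ ν - b y μ ν) - cD V κ (fun w => b w μ ν) y)
          + ((b (y + e μ) ν κ - b y ν κ) - cD V μ (fun w => b w ν κ) y)‖
        + ‖(b (y + e ν) κ μ - b y κ μ) - cD V ν (fun w => b w κ μ) y‖ := norm_add_le _ _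
    _ ≤ _ := by
        have h12 := norm_add_le ((b (y + e κ) μ ν - b y μ ν) - cD V κ (fun w => b w μ ν) y)
          ((b (y + e μ) ν κ - b y ν κ) - cD V μ (fun w => b w ν κ) y)
        linarith

end

end Summit.QuantumFields.BalabanUV.T4Continuum.NE7FluxHodgeDivForm
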